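import Summits.BirchSwinnertonDyer.BirchSwinnertonDyer.Theorems.ManinLocalTwoThreeCThreeResidualOfFourFacts
import Summits.BirchSwinnertonDyer.BirchSwinnertonDyer.Theorems.ManinLocalTwoThreeParOddTwoOfFacts
import Summits.BirchSwinnertonDyer.BirchSwinnertonDyer.Theorems.ManinLocalTwoThreeKatoShiftTwoReal
import Summits.BirchSwinnertonDyer.BirchSwinnertonDyer.Theorems.ManinLocalTwoThreeTwistOrbitMinimalResidualSynthesis
import Literature.NumberTheory.EllipticCurves.KatoAdditiveTwistedValueNeronIntegralityTwoReal
import HarnessLib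

/-!
# C2 `ManinOddAtFour` BY NAME from five NAMED inputs and the orbit-minimal reducible residual (lead integration, v7)

Summit `BirchSwinnertonDyer`, route `ManinLocalTwoThree` (cell bsd-f2-manin), deciding crux C2 `ManinOddAtFour`
(stmt-BirchSwinnertonDyer-22967), line `kato_shift_two` (lead p1).  The §25 chain of the cell (MEMO-es §25; REF1 §R47) is now
entirely in the tree: leaves E-es-36o/36x (p605979), E-es-38 `oddShiftReduction` (p605636), LEMMA C (p604131), E-es-42
`atkinLehnerStep_holds` (p606740), the `t = 2` vertex (p606516), the odd-`t` vertex modulo F-es-27′ (p606925), the index-2 descent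
E-es-37 `shiftInvariantDescentTwo_two_of_two_le` (p607037/p607202, p607636, p608085, p608494), the `t = 2` leaf and the
`C₃`-residual closers modulo named inputs (p607097, p607316, p608031).  This file records the resulting state of the crux
KERNEL-EXACTLY, with every remaining input a NAMED tree `Prop`:

* inputs: E-es-22 `MultiShiftClassGenerationTwo` from FOUR named Props (p3's `multiShiftClassGenerationTwo_of_facts`, p609198):
  the Literature facts F-es-27′ `sl2ZModOddPrime_existsUnique_extension_of_stable_character` (H²(SL₂(𝔽_t);𝔽₂) = 0, `t` odd) and
  E-es-43 `gamma0Away_character_extension_of_shiftInvariant` (abelianised Serre amalgam), and the two Chebotarev leaves E-es-40₂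
  `NotTrivialEisensteinOfIrreducibleAtTwo`, E-es-40 `NotTrivialEisensteinOfIrreducibleTwo` (`@[conjecture]` defs);
* `katoShiftTwistManinTwo_of_namedInputs` — E-es-21 from F♯ and the four Props;
* (the registered stub 3 of `kato_shift_two` v6, its signature verbatim, from the same four Props is p2's
  `cThreeImageResidual_of_facts`, p608851 — not restated here);
* **`maninOddAtFour_of_namedInputs`** — the ROUTE DECL `Theses.ManinLocalTwoThree.ManinOddAtFour` from: the real-subfield Kato
  fact F♯ `kato_neron_isIntegral_twistedSymbolSum_of_additive_two_real` (Literature, statement-only), the four Props above, and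
  the ORBIT-MINIMAL `W[2]`-REDUCIBLE RESIDUAL (stub 4 of v6, verbatim) — via `katoShiftTwistManinTwo_of_realKatoFact_of_generation`,
  `katoManinOddTwo_of_realKatoFact_of_generation` (p599224) and p2's orbit-minimal synthesis
  `maninLocalTwoThree_maninOddAtFour_of_orbitMinimalKatoShift_of_orbitMinimalResiduals`;
* `maninOddAtFour_of_namedInputs_of_reducible` — the same with the unrestricted reducible residual `ManinOddOfReducibleAtFour`.

These are CONDITIONAL results (the gate's `proof.conditional`): C2 is thereby reduced to {Kato F♯, F-es-27′, E-es-43, two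
Chebotarev statements} — all printed or standard, none open — plus the reducible residual Rb, which IS open mathematics (Manin's
conjecture at 2 for curves with a rational 2-isogeny, additive at 2).  No new definitions.  Nothing about BSD is proved here;
Manin's conjecture is not proved here.  References: cell memos HOME/MEMO-es.md §21–§25, HOME/MEMO-an.md §54; K. Kato, Astérisque 295
(2004) Thm. 9.7/12.5; J.-P. Serre, *Trees* II.1.4; A. Wiles, Ann. of Math. 141 (1995) Lemma 2.5.
-/

set_option autoImplicit false
set_option linter.dupNamespace false

noncomputable section

open scoped Classical MatrixGroups ModularForm
open CongruenceSubgroup WeierstrassCurve Literature.NumberTheory.EllipticCurves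
  Literature.NumberTheory.EllipticCurves.ModularForms
  Literature.NumberTheory.EllipticCurves.ModularForms.HidaCohomology
  Literature.GroupTheory.SpecificGroups
  Summit.BirchSwinnertonDyer.Rank1Residual.ManinAdditive

namespace Summit.BirchSwinnertonDyer.BirchSwinnertonDyer.Theorems.ManinLocalTwoThree

/-- **E-es-21 `KatoShiftTwistManinTwo` from F♯ and the four named Props.** [cite: Kato2004Asterisque, Thm. 9.7 (p. 189)] -/
theorem katoShiftTwistManinTwo_of_namedInputs
    (hF : kato_neron_isIntegral_twistedSymbolSum_of_additive_two_real)
    (h27 : sl2ZModOddPrime_existsUnique_extension_of_stable_character)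
    (h43 : gamma0Away_character_extension_of_shiftInvariant)
    (hNT2 : NotTrivialEisensteinOfIrreducibleAtTwo) (hNT : NotTrivialEisensteinOfIrreducibleTwo) :
    KatoShiftTwistManinTwo :=
  katoShiftTwistManinTwo_of_realKatoFact_of_generation hF (multiShiftClassGenerationTwo_of_facts h27 h43 hNT2 hNT)

/-- **C2 `ManinOddAtFour` BY NAME from five named inputs and the ORBIT-MINIMAL reducible residual** (stub 4 of `kato_shift_two`
v6 verbatim): F♯ + E-es-22 (from F-es-27′, E-es-43, E-es-40₂, E-es-40) give E-es-21 and the archimedean residual on the irreducible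
locus (`katoShiftTwistManinTwo_of_realKatoFact_of_generation`, `katoManinOddTwo_of_realKatoFact_of_generation`); p2's orbit-minimal
synthesis closes the route decl given Manin-at-2 on the twist-orbit-minimal `W[2]`-reducible classes.  CONDITIONAL result; the
reducible residual is open. [cite: Kato2004Asterisque, Thm. 9.7 (p. 189)] -/
theorem maninOddAtFour_of_namedInputs
    (hF : kato_neron_isIntegral_twistedSymbolSum_of_additive_two_real)
    (h27 : sl2ZModOddPrime_existsUnique_extension_of_stable_character)
    (h43 : gamma0Away_character_extension_of_shiftInvariant)
    (hNT2 : NotTrivialEisensteinOfIrreducibleAtTwo) (hNT : NotTrivialEisensteinOfIrreducibleTwo)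
    (hRb : ∀ (W : WeierstrassCurve ℚ) [W.IsElliptic] [W.IsGloballyMinimal] {N : ℕ} [NeZero N]
      (D : ModularParametrizationData W N),
      (∀ z ∈ D.L.lattice, ∃ w ∈ periodLattice D.f, z = D.c * w) → 2 ^ 2 ∣ N →
      ¬ (∃ (W' : WeierstrassCurve ℚ) (d : ℤ), W'.IsElliptic ∧ W'.IsGloballyMinimal ∧
        (d = -1 ∨ d = 2 ∨ d = -2) ∧ IsIsogenous W (W'.quadraticTwist (d : ℚ)) ∧
        ¬ 2 ^ 2 ∣ W'.conductorNorm ℤ) →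
      ¬ (∃ (W' : WeierstrassCurve ℚ) (q : ℕ), W'.IsElliptic ∧ W'.IsGloballyMinimal ∧
        q.Prime ∧ q ≠ 2 ∧ q ^ 2 ∣ N ∧
        IsIsogenous W (W'.quadraticTwist (((-1 : ℤ) ^ (q / 2) * q : ℤ) : ℚ)) ∧
        ¬ q ^ 2 ∣ W'.conductorNorm ℤ) →
      ¬ (∃ (A : WeierstrassCurve ℚ), A.IsElliptic ∧ A.IsGloballyMinimal ∧ 2 ^ 4 ∣ N ∧
        2 ^ 2 ∣ A.conductorNorm ℤ ∧ A.conductorNorm ℤ ∣ N ∧ A.conductorNorm ℤ < N ∧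
        IsIsogenous W (A.quadraticTwist ((-1 : ℤ) : ℚ))) →
      ¬ (∃ (A : WeierstrassCurve ℚ) (_ : A.IsElliptic) (_ : A.IsGloballyMinimal) (N' : ℕ) (_ : NeZero N')
        (D' : ModularParametrizationData A N') (d : ℤ) (C : WeierstrassCurve ℚ) (u : VariableChange ℚ),
        C.IsElliptic ∧ C.IsGloballyMinimal ∧
        (∀ z ∈ D'.L.lattice, ∃ w ∈ periodLattice D'.f, z = D'.c * w) ∧ (d = 2 ∨ d = -2) ∧ 2 ^ 6 ∣ N ∧
        2 ^ 2 ∣ A.conductorNorm ℤ ∧ A.conductorNorm ℤ ∣ N ∧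
        IsIsogenous W (A.quadraticTwist (d : ℚ)) ∧ u • A.quadraticTwist (d : ℚ) = C ∧
        C.Δ = (d : ℚ) ^ 6 * A.Δ ∧
        (A.conductorNorm ℤ < N ∨ A.minimalDiscriminantInt.natAbs < W.minimalDiscriminantInt.natAbs)) →
      ¬ (∃ (A : WeierstrassCurve ℚ) (_ : A.IsElliptic) (_ : A.IsGloballyMinimal)
        (D' : ModularParametrizationData A N) (q : ℕ) (C : WeierstrassCurve ℚ) (u : VariableChange ℚ),
        C.IsElliptic ∧ C.IsGloballyMinimal ∧
        (∀ z ∈ D'.L.lattice, ∃ w ∈ periodLattice D'.f, z = D'.c * w) ∧ q.Prime ∧ q ≠ 2 ∧ q ^ 2 ∣ N ∧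
        IsIsogenous C W ∧ u • A.quadraticTwist (((-1 : ℤ) ^ (q / 2) * q : ℤ) : ℚ) = C ∧
        C.Δ = ((((-1 : ℤ) ^ (q / 2) * q : ℤ)) : ℚ) ^ 6 * A.Δ ∧
        A.minimalDiscriminantInt.natAbs < W.minimalDiscriminantInt.natAbs) →
      ¬ W.HasIrreducibleModPGaloisRep 2 → ¬ (2 : ℤ) ∣ D.c) :
    Summit.BirchSwinnertonDyer.BirchSwinnertonDyer.Theses.ManinLocalTwoThree.ManinOddAtFour :=
  have hG : MultiShiftClassGenerationTwo := multiShiftClassGenerationTwo_of_facts h27 h43 hNT2 hNT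
  Summit.BirchSwinnertonDyer.BirchSwinnertonDyer.Theorems.maninLocalTwoThree_maninOddAtFour_of_orbitMinimalKatoShift_of_orbitMinimalResiduals
    (fun W _ _ _ _ D hopt h4 _ _ _ _ _ hirr =>
      katoShiftTwistManinTwo_of_realKatoFact_of_generation hF hG W D hopt h4 hirr)
    (fun W _ _ _ _ D hopt h4 _ _ _ _ _ hirr _ _ =>
      katoManinOddTwo_of_realKatoFact_of_generation hF hG W D hopt h4 hirr)
    hRb

/-- **C2 `ManinOddAtFour` BY NAME from five named inputs and the UNRESTRICTED reducible residual `ManinOddOfReducibleAtFour`.**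
CONDITIONAL result. [cite: Kato2004Asterisque, Thm. 9.7 (p. 189)] -/
theorem maninOddAtFour_of_namedInputs_of_reducible
    (hF : kato_neron_isIntegral_twistedSymbolSum_of_additive_two_real)
    (h27 : sl2ZModOddPrime_existsUnique_extension_of_stable_character)
    (h43 : gamma0Away_character_extension_of_shiftInvariant)
    (hNT2 : NotTrivialEisensteinOfIrreducibleAtTwo) (hNT : NotTrivialEisensteinOfIrreducibleTwo)
    (hRb : ManinOddOfReducibleAtFour) :
    Summit.BirchSwinnertonDyer.BirchSwinnertonDyer.Theses.ManinLocalTwoThree.ManinOddAtFour :=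
  maninOddAtFour_of_realKatoFact_of_generation_of_reducible hF (multiShiftClassGenerationTwo_of_facts h27 h43 hNT2 hNT) hRb

end Summit.BirchSwinnertonDyer.BirchSwinnertonDyer.Theorems.ManinLocalTwoThree

end
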